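import Literature.NumberTheory.Automorphic.CDTTheorem712
import Literature.NumberTheory.EllipticCurves.ModFiveCongruenceHesseFamily
import Literature.NumberTheory.EllipticCurves.GlobalMinimalModel
import Literature.NumberTheory.EllipticCurves.Tamagawa
import Literature.NumberTheory.EllipticCurves.WeilPairingProofs
import Literature.NumberTheory.EllipticCurves.VariableChangePoints
import Mathlib.NumberTheory.LSeries.PrimesInAP
import HarnessLib

/-!
# stub-ideation k1 (GEN 3, FAMILY 1 — recognise & import) for `stub_switch` = `CDT_three_five_switch`

Sketch file of seat `sidea-stmt-ABC-11340-stub_switch-1-g3` (crux `FreyModularity`, stmt-ABC-11340, line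
`Lines/Sketch.lean`, `stub_switch_iff_CDT_three_five_switch : (…) ↔ CDT_three_five_switch := Iff.rfl`).
Companion of `STUB-IDEAS-stub_switch-1.md` (gen 3).  Supersedes nothing: gen-2's
`STUB_IDEAS_stub_switch_1_Sketch.lean` (atoms Δ/G/D/T/F1/F2/R_Ψ/R_F) stays valid; THIS file discharges
gen-2's one residual atom `R_F = HessePencilFrobeniusCert` ("some member of the Hesse pencil of `W` has a
good prime `q ≡ 2 (mod 3)` with `3 ∤ a_q`") by a UNIFORM finite-field road with NO Hilbert irreducibility,
NO Chebotarev and NO condition at `3`: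

  Dirichlet (`q ≡ 2 mod 15`, Mathlib) → reps mod 15 (S) → **Deuring 1941 / Waterhouse 1969 Thm 4.1**
  (NEW named fact N1: an ordinary curve `E₀/𝔽_q` with any trace `0 < |t'| < 2√q`) → Frobenius class ⇒
  direct `5`-congruence over `𝔽_q` (M, linear algebra in `GL₂(𝔽₅)` + Manin's relation + Weil pairing, all
  in the tree) → **Fisher 2012 Thm 13.2 (ii) over the perfect field `𝔽_q`** (NEW named fact N2 = the
  general form the tree's `thm132_geomTorsionFive_of_hesseFamily` docstring marks `TODO`) → lift
  `(λ̄:μ̄)` to `ℤ` → the member `E_{λ,μ}/ℚ` has good reduction at `q` with `a_q(E_{λ,μ}) = t' ≢ 0 (mod 3)`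
  (M) → gen-2 atom F2 (`Frob_q` of order `8` in `GL₂(𝔽₃)`, tree theorem
  `Theorems.isAbsIrreducibleOverSqrt_negThree_of_orderOf_eq_eight`) → the switch.

Everything below ELABORATES (`lean check` rc 0); `sorry` occurs ONLY in the three open helper lemmas
`directCongrFive_of_trace_modEq` (L3, M), `isElliptic_memberF_of_zmod` (L6a, S), `member_reduction`
(L6, M); L0/L1/L2/L3a/L3b/L4/L5 are PROVED here; the two named facts are `def … : Prop` atoms; the
assembly `switch_of_deuringRoad` is kernel-checked from them.  Numerical check of the joint prediction
N1+N2+L3 (every pencil over `𝔽_q`, `q ∈ {17,23,47}`, realises EXACTLY its trace class mod 5; control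
failures at `q ∈ {19,31}` sit on the repeated-eigenvalue classes): see the .md §3.
-/

set_option linter.dupNamespace false

namespace Summit.ABC.ABC.Cruxes.FreyModularity.StubSwitchK1G3

open Literature.NumberTheory.EllipticCurves Literature.NumberTheory.EllipticCurves.HesseFamilyFive
open Literature.NumberTheory.Automorphic Literature.NumberTheory.GaloisRepresentations
open Literature.NumberTheory.Automorphic.BCDT WeierstrassCurve Field

noncomputable section

universe u

/-! ## §0 Objects -/

/-- Fisher's base model `E : y² = x³ − 27c₄x − 54c₆` over any field. [Fisher2012Hessian, Thm 13.2] -/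
abbrev baseF {F : Type u} [Field F] (c₄ c₆ : F) : WeierstrassCurve F := ⟨0, 0, 0, -27 * c₄, -54 * c₆⟩

/-- The Hesse member `E_{l,m} : y² = x³ − 27𝔠₄(l,m)x − 54𝔠₆(l,m)` over any field (tree polynomials
`HesseFamilyFive.C4/C6/D` are polymorphic; `C4, C6` divide by `17424 = 2⁴3²11²` and `240 = 2⁴·3·5`, so
reduction mod `q` is compatible for `q ∉ {2,3,5,11}`). [Fisher2012Hessian, §8] -/
abbrev memberF {F : Type u} [Field F] (c₄ c₆ l m : F) : WeierstrassCurve F :=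
  ⟨0, 0, 0, -27 * C4 c₄ c₆ l m, -54 * C6 c₄ c₆ l m⟩

/-- The trace `a = q + 1 − #V(𝔽_q)` of a curve over the prime field (= the tree's `HasseManin.tr V`;
restated with `Nat.card` so that no `Fintype (ZMod q)` instance is needed in statements). -/
def trace (q : ℕ) (V : WeierstrassCurve (ZMod q)) : ℤ := (q : ℤ) + 1 - Nat.card V.toAffine.Point

/-- **Direct `5`-congruence over a field `F`** ([Fisher2012Hessian] Def. 13.1): a `Γ_F`-equivariant
isomorphism of the geometric `5`-torsion that respects the Weil pairings `e₅` (tree `weilPairingFun`). -/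
def DirectCongrFive {F : Type u} [Field F] (W₁ W₂ : WeierstrassCurve F) [W₁.IsElliptic] [W₂.IsElliptic]
    (h5 : ((5 : ℕ) : F) ≠ 0) : Prop :=
  ∃ e : W₁.geomTorsion 5 ≃+ W₂.geomTorsion 5,
    (∀ (σ : absoluteGaloisGroup F) (P : W₁.geomTorsion 5), e (σ • P) = σ • e P) ∧
    ∀ P Q : W₁.geomTorsion 5,
      weilPairingFun h5 ((e P : W₂.geomTorsion 5) : W₂.geomPoints) ((e Q : W₂.geomTorsion 5) : W₂.geomPoints)
        = weilPairingFun h5 (P : W₁.geomPoints) (Q : W₁.geomPoints)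

/-! ## §1 The two NEW named facts (to vendor under `Literature/`, D-0014 named-fact form) -/

/-- **N1 — Deuring 1941 / Waterhouse 1969 Thm 4.1 (1), prime field, ordinary case.**  For a prime `p`
and an integer `t` with `p ∤ t` (here: `t ≠ 0`, `t² < 4p`) there is an elliptic curve over `𝔽_p` with
`#E(𝔽_p) = p + 1 − t`.  (Deuring, Abh. Math. Sem. Hamburg 14 (1941) 197–272; Waterhouse, Ann. Sci. ÉNS
(4) 2 (1969) 521–560, Thm 4.1; Schoof, J. Combin. Th. A 46 (1987), Thm 4.2/(4.6); Rück 1987.)  Proof in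
print: CM lifting / Honda–Tate; XL to formalise, S to vendor. -/
def DeuringOrdinaryExistence : Prop :=
  ∀ (p : ℕ) [Fact p.Prime] (t : ℤ), t ≠ 0 → t ^ 2 < 4 * (p : ℤ) →
    ∃ V : WeierstrassCurve (ZMod p), V.IsElliptic ∧ trace p V = t

/-- **N2 — Fisher 2012 Thm 13.2, `n = 5`, GENERAL FORM** (perfect field `K`, `char K ∤ 30`, BOTH
directions, with the Weil-pairing clause of Def. 13.1): `E'` is directly `5`-congruent to
`E : y² = x³ − 27c₄x − 54c₆` over `K` iff `E' ≅_K E_{λ,μ}` for some `λ, μ ∈ K`.  ONE vendored statement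
serving k3-g2's `Thm132iiMemHesseFamily` (`K ⊆ ℚ̄` a number field) AND this road (`K = 𝔽_q`); direction
(i) over `ℚ` without the Weil clause is the tree's `thm132_geomTorsionFive_of_hesseFamily`.
[Fisher2012Hessian, Thm 13.2 + Def 13.1, PLMS 104 (2012) = arXiv:math/0610403 p.19; field hypothesis p.4
L3 "We work over a perfect field K of characteristic not dividing 6n"] -/
def Thm132General : Prop :=
  ∀ (F : Type) [Field F] [PerfectField F] (h5 : ((5 : ℕ) : F) ≠ 0), (6 : F) ≠ 0 →
    ∀ (E E' : WeierstrassCurve F) [E.IsElliptic] [E'.IsElliptic] (c₄ c₆ : F), E = baseF c₄ c₆ →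
      (DirectCongrFive E E' h5 ↔ ∃ (l m : F) (C : VariableChange F), C • E' = memberF c₄ c₆ l m)

/-- **N2′ — the instance this road consumes:** direction (ii) over a prime field `𝔽_q`, `q ≥ 7`. -/
def Thm132iiPrimeField : Prop :=
  ∀ (q : ℕ) [Fact q.Prime], 7 ≤ q → ∀ (h5 : ((5 : ℕ) : ZMod q) ≠ 0)
    (E E' : WeierstrassCurve (ZMod q)) [E.IsElliptic] [E'.IsElliptic] (c₄ c₆ : ZMod q),
    E = baseF c₄ c₆ → DirectCongrFive E E' h5 →
      ∃ (l m : ZMod q) (C : VariableChange (ZMod q)), C • E' = memberF c₄ c₆ l m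

/-- N2 ⇒ N2′ (finite fields are perfect: Mathlib `PerfectField.ofFinite`). -/
theorem thm132iiPrimeField_of_general (h : Thm132General) : Thm132iiPrimeField := by
  intro q _ hq h5 E E' _ _ c₄ c₆ hE hc
  have h6 : (6 : ZMod q) ≠ 0 := by
    have : ((6 : ℕ) : ZMod q) ≠ 0 := by
      rw [Ne, ZMod.natCast_eq_zero_iff]
      intro hd
      have := Nat.le_of_dvd (by norm_num) hd
      omega
    simpa using this
  exact (h (ZMod q) h5 h6 E E' c₄ c₆ hE).mp hc

/-! ## §2 Helper lemmas (S/M) — the statements a stub prover lands; `sorry` only here -/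

/-- **L0 (S; = k3-g2 G6a+G6b):** integral invariants — `W ≅_ℚ baseF c₄ c₆` with `c₄, c₆ ∈ ℤ`
(`fisherChange_smul` + `scale_smul_short` with `u⁴W.c₄, u⁶W.c₆ ∈ ℤ`), hence `Congr W (baseF c₄ c₆)`
(`congr_of_smul_eq`), and `c₄³ ≠ c₆²` (`c_relation`). PROVED. [SilvermanAEC2009, III.1] -/
theorem exists_integral_base (W : WeierstrassCurve ℚ) [W.IsElliptic] :
    ∃ (c₄ c₆ : ℤ) (C : VariableChange ℚ), (c₄ : ℚ) ^ 3 ≠ (c₆ : ℚ) ^ 2 ∧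
      C • W = baseF (c₄ : ℚ) (c₆ : ℚ) := by
  -- clear denominators: `u = den(c₄)·den(c₆)`, `u⁴c₄ = num(c₄)den(c₄)³den(c₆)⁴`, `u⁶c₆ = num(c₆)den(c₄)⁶den(c₆)⁵`
  set d₄ : ℤ := (W.c₄.den : ℤ) with hd₄
  set d₆ : ℤ := (W.c₆.den : ℤ) with hd₆
  have hd₄0 : (d₄ : ℚ) ≠ 0 := by rw [hd₄]; exact_mod_cast W.c₄.den_nz
  have hd₆0 : (d₆ : ℚ) ≠ 0 := by rw [hd₆]; exact_mod_cast W.c₆.den_nz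
  have hu : ((d₄ * d₆ : ℤ) : ℚ) ≠ 0 := by push_cast; exact mul_ne_zero hd₄0 hd₆0
  have h4 : (W.c₄.num : ℚ) = W.c₄ * (d₄ : ℚ) := by
    rw [hd₄]; push_cast; exact_mod_cast (Rat.mul_den_eq_num W.c₄).symm
  have h6 : (W.c₆.num : ℚ) = W.c₆ * (d₆ : ℚ) := by
    rw [hd₆]; push_cast; exact_mod_cast (Rat.mul_den_eq_num W.c₆).symm
  refine ⟨W.c₄.num * d₄ ^ 3 * d₆ ^ 4, W.c₆.num * d₄ ^ 6 * d₆ ^ 5,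
    ⟨Units.mk0 ((d₄ * d₆ : ℤ) : ℚ)⁻¹ (inv_ne_zero hu), 0, 0, 0⟩ * fisherChange W, ?_, ?_⟩
  · -- `c₄³ ≠ c₆²` since `(u⁴c₄)³ − (u⁶c₆)² = u¹²(c₄³ − c₆²)` and `1728Δ = c₄³ − c₆² ≠ 0`
    have hW : W.c₄ ^ 3 - W.c₆ ^ 2 ≠ 0 := by
      rw [← W.c_relation]; exact mul_ne_zero (by norm_num) W.isUnit_Δ.ne_zero
    intro h
    apply hW
    push_cast at h
    rw [h4, h6] at h
    have h' : ((d₄ : ℚ) * d₆) ^ 12 * (W.c₄ ^ 3 - W.c₆ ^ 2) = 0 := by linear_combination h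
    rcases mul_eq_zero.mp h' with h0 | h0
    · exact absurd h0 (pow_ne_zero _ (mul_ne_zero hd₄0 hd₆0))
    · exact h0
  · rw [mul_smul, fisherChange_smul, scale_smul_short _ hu]
    push_cast
    rw [h4, h6]
    ext <;> simp <;> ring

/-- **L1 (S; Dirichlet = Mathlib `Nat.forall_exists_prime_gt_and_eq_mod`):** a prime `q ≡ 2 (mod 15)`
above any bound (so `q ≡ 2 (mod 3)` and `q ≡ 2 (mod 5)`, a non-square). PROVED. -/
theorem exists_prime_gt_mod15 (N : ℕ) : ∃ q : ℕ, q.Prime ∧ N < q ∧ q % 15 = 2 := by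
  have h2 : IsUnit ((2 : ℕ) : ZMod 15) := by decide
  obtain ⟨q, hgt, hp, hmod⟩ := Nat.forall_exists_prime_gt_and_eq_mod h2 N
  refine ⟨q, hp, hgt, ?_⟩
  have := (ZMod.natCast_eq_natCast_iff' q 2 15).1 hmod
  simpa using this

/-- **L2 (S; CRT by hand):** every class mod `5` has a representative `t' ∈ {1, 2, 4, 5, −2}` with
`3 ∤ t'` (so `t' ≠ 0`) and `t'² ≤ 25 < 4q` for `q ≥ 7`. PROVED. -/
theorem exists_traceRep (q : ℕ) (hq : 7 ≤ q) (t : ℤ) :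
    ∃ t' : ℤ, (t' : ZMod 5) = (t : ZMod 5) ∧ ¬ (3 : ℤ) ∣ t' ∧ t' ^ 2 < 4 * (q : ℤ) := by
  have key : ∀ r : ZMod 5, ∃ t' ∈ ({1, 2, 4, 5, -2} : Finset ℤ), (t' : ZMod 5) = r := by decide
  obtain ⟨t', ht'mem, ht'⟩ := key (t : ZMod 5)
  refine ⟨t', ht', ?_, ?_⟩
  · simp only [Finset.mem_insert, Finset.mem_singleton] at ht'mem
    rcases ht'mem with rfl | rfl | rfl | rfl | rfl <;> decide
  · have hsq : t' ^ 2 ≤ 25 := by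
      simp only [Finset.mem_insert, Finset.mem_singleton] at ht'mem
      rcases ht'mem with rfl | rfl | rfl | rfl | rfl <;> norm_num
    have : (28 : ℤ) ≤ 4 * (q : ℤ) := by omega
    omega

/-- **L3a (S, `decide`):** for `q ≡ ±2 (mod 5)` the characteristic polynomial `X² − tX + q` of Frobenius
on the `5`-torsion is separable, whatever `t`. PROVED. -/
theorem disc_ne_zero_mod5 : ∀ t d : ZMod 5, d = 2 ∨ d = 3 → t ^ 2 - 4 * d ≠ 0 := by decide

/-- **L3b (S, `decide`):** the norm form `a² + abt + b²d` of `𝔽₅[x]/(x² − tx + d)` represents every unit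
(so a Frobenius-equivariant `𝔽₅`-isomorphism can be renormalised to be SYMPLECTIC). PROVED. -/
theorem normForm_onto_units_mod5 :
    ∀ t d r : ZMod 5, t ^ 2 - 4 * d ≠ 0 → r ≠ 0 → ∃ a b : ZMod 5, a ^ 2 + a * b * t + b ^ 2 * d = r := by
  decide

/-- **L3 (M): equal traces mod `5` ⇒ direct `5`-congruence over `𝔽_q`, for `q ≡ ±2 (mod 5)`.**
Both `(V[5], Frob_q)` and `(V'[5], Frob_q)` are `2`-dimensional `𝔽₅`-spaces with an automorphism of
characteristic polynomial `X² − t̄X + q̄` (trace: Manin's pointwise relation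
`frobenius_sq_sub_trace_smul_add_card_smul`, tree, PROVED, plus `det = q̄` from `weilPairingFun_smul` and
non-degeneracy; a scalar Frobenius is impossible as `q̄` is a non-square); the polynomial is separable
(L3a), so both are cyclic `𝔽₅[X]`-modules ≅ `𝔽₅[X]/(X² − t̄X + q̄)`, isomorphic by some `e` commuting with
Frobenius; the isomorphisms form a torsor under `(𝔽₅[X]/(·))ˣ` whose norms exhaust `𝔽₅ˣ` (L3b), so `e`
can be taken symplectic; `Γ_{𝔽_q}` acts on the finite sets `V[5] ∪ V'[5]` through powers of `Frob_q`
(`exists_smul_eq_frobenius_pow_smul_of_finite₂`, tree), so `e` is `Γ_{𝔽_q}`-equivariant.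
Leans on: `exists_frobenius_absoluteGaloisGroup`, `finrank_zmod_geomTorsion_eq_two`,
`weilPairingFun_{add_left,add_right,smul,pow}`, Mathlib `Matrix`/`LinearMap.charpoly`. [Schoof 1987 §4;
SilvermanAEC2009 III.8, V.2] -/
theorem directCongrFive_of_trace_modEq (q : ℕ) [Fact q.Prime] (hq5 : q % 5 = 2 ∨ q % 5 = 3)
    (h5 : ((5 : ℕ) : ZMod q) ≠ 0) (V V' : WeierstrassCurve (ZMod q)) [V.IsElliptic] [V'.IsElliptic]
    (htr : (trace q V : ZMod 5) = (trace q V' : ZMod 5)) : DirectCongrFive V V' h5 := by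
  sorry

/-- **L4 (S): the base curve mod `q`** is elliptic when `q ∤ 6(c₄³ − c₆²)` (`Δ = 2⁶3⁹(c₄³ − c₆²)`). PROVED. -/
theorem isElliptic_baseF_zmod (q : ℕ) [Fact q.Prime] (hq : 7 ≤ q) (c₄ c₆ : ℤ)
    (hc : ¬ (q : ℤ) ∣ c₄ ^ 3 - c₆ ^ 2) : (baseF (c₄ : ZMod q) (c₆ : ZMod q)).IsElliptic := by
  have hprime : ∀ n : ℕ, 0 < n → n < 7 → ((n : ℕ) : ZMod q) ≠ 0 := by
    intro n hn hn7 h0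
    rw [ZMod.natCast_eq_zero_iff] at h0
    have := Nat.le_of_dvd hn h0
    omega
  have h2 : (2 : ZMod q) ≠ 0 := by simpa using hprime 2 (by norm_num) (by norm_num)
  have h3 : (3 : ZMod q) ≠ 0 := by simpa using hprime 3 (by norm_num) (by norm_num)
  have hc' : (c₄ : ZMod q) ^ 3 - (c₆ : ZMod q) ^ 2 ≠ 0 := by
    intro h0
    apply hc
    rw [← ZMod.intCast_zmod_eq_zero_iff_dvd]
    push_cast
    exact h0
  have hΔ : (baseF (c₄ : ZMod q) (c₆ : ZMod q)).Δ =
      2 ^ 6 * 3 ^ 9 * ((c₄ : ZMod q) ^ 3 - (c₆ : ZMod q) ^ 2) := by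
    simp only [WeierstrassCurve.Δ, WeierstrassCurve.b₂, WeierstrassCurve.b₄, WeierstrassCurve.b₆,
      WeierstrassCurve.b₈]
    ring
  rw [WeierstrassCurve.isElliptic_iff, hΔ, isUnit_iff_ne_zero]
  exact mul_ne_zero (mul_ne_zero (pow_ne_zero _ h2) (pow_ne_zero _ h3)) hc'

/-- **L5 (S): the trace is an isomorphism invariant over `𝔽_q`** (`#(C • V)(𝔽_q) = #V(𝔽_q)`, tree
`VariableChange.pointEquiv`). PROVED. -/
theorem trace_smul (q : ℕ) [Fact q.Prime] (V : WeierstrassCurve (ZMod q)) (C : VariableChange (ZMod q)) :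
    trace q (C • V) = trace q V := by
  unfold trace
  rw [Nat.card_congr (VariableChange.pointEquiv V C).toEquiv]

/-- **L6a (S): ellipticity lifts from `𝔽_q` to `ℚ`** (`q ≥ 17`: the member's `Δ ∈ ℤ[1/330]` reduces
to `Δ(E_{l̄,m̄}) ≠ 0`, so `Δ ≠ 0`). -/
theorem isElliptic_memberF_of_zmod (c₄ c₆ l m : ℤ) (q : ℕ) [Fact q.Prime] (hq : 17 ≤ q)
    (hE : (memberF (c₄ : ZMod q) (c₆ : ZMod q) (l : ZMod q) (m : ZMod q)).IsElliptic) :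
    (memberF (c₄ : ℚ) (c₆ : ℚ) (l : ℚ) (m : ℚ)).IsElliptic := by
  sorry

/-- **L6 (M): reduction of a lifted member.**  For integers `c₄, c₆, l, m` and a prime `q ≥ 17` (so
`q ∤ 2·3·5·11`, the denominators of `𝔠₄, 𝔠₆`) such that the member `E_{l̄,m̄}` of the REDUCED pencil is
elliptic over `𝔽_q`: the member `E_{l,m}/ℚ` (elliptic, L6a) is `q`-integral with unit discriminant at `q`
(`Rat.cast_{add,mul}_of_ne_zero`: reduction commutes with the polynomial formulas), hence any globally
minimal model `C • E_{l,m}` is `ℤ_(q)`-isomorphic to it (`valuation_u_eq_one_of_isMinimal`,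
`exists_int_cast_eq_rst_of_isIntegral`, tree), has good reduction at `q`
(`HasGoodReductionAtPrime` = the `ℤ_q`-minimal model has unit `Δ`), and its `frobeniusTrace`
(`= q + 1 − reductionPointCount`) is the trace of `E_{l̄,m̄}/𝔽_q` (isomorphic reductions, L5).
[SilvermanAEC2009, VII.1–VII.2, Prop. VII.5.4] -/
theorem member_reduction (c₄ c₆ l m : ℤ) (q : ℕ) [Fact q.Prime] (hq : 17 ≤ q)
    (hE : (memberF (c₄ : ZMod q) (c₆ : ZMod q) (l : ZMod q) (m : ZMod q)).IsElliptic)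
    (C : VariableChange ℚ)
    [hmin : (C • memberF (c₄ : ℚ) (c₆ : ℚ) (l : ℚ) (m : ℚ)).IsGloballyMinimal] :
    (C • memberF (c₄ : ℚ) (c₆ : ℚ) (l : ℚ) (m : ℚ)).HasGoodReductionAtPrime q ∧
      (C • memberF (c₄ : ℚ) (c₆ : ℚ) (l : ℚ) (m : ℚ)).frobeniusTrace q =
        trace q (memberF (c₄ : ZMod q) (c₆ : ZMod q) (l : ZMod q) (m : ZMod q)) := by
  sorry

/-- **F2 = gen-2 atom `FrobeniusCertificate` (M), VERBATIM** (k1-g2 `STUB_IDEAS_stub_switch_1_Sketch.lean`):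
ONE good prime `q ≡ 2 (mod 3)` with `3 ∤ a_q` makes every framed `ρ̄_{E,3}` absolutely irreducible over
`ℚ(√-3)` (`Frob_q` has `det = q̄ = −1`, `tr = ā_q ≠ 0` in `GL₂(𝔽₃)`, hence order `8`; tree theorems
`trace/det_galoisRepTorsion_frobenius_eq` (PROVED) and
`Theorems.isAbsIrreducibleOverSqrt_negThree_of_orderOf_eq_eight` (PROVED)). [Manoharmayum 1999 Prop 2.3.3;
ConradDiamondTaylor1999 p. 556] -/
def FrobeniusCertificate : Prop :=
  ∀ (W : WeierstrassCurve ℚ) [W.IsElliptic] [W.IsGloballyMinimal] (q : ℕ) [Fact q.Prime],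
    q % 3 = 2 → W.HasGoodReductionAtPrime q → ¬ (3 : ℤ) ∣ W.frobeniusTrace q →
    ∀ ρ₃ : ModPGaloisRep ℚ (ZMod 3) 2, W.IsTorsionGaloisRep 3 ρ₃ → ρ₃.IsAbsIrreducibleOverSqrt (-3)

/-! ## §3 Proved plumbing -/

/-- Transport of a framed `5`-torsion model along a `5`-congruence (k3/k1-g2, reproduced). -/
theorem isTorsionGaloisRep_of_congr {W W' : WeierstrassCurve ℚ} (h : Congr W' W)
    {ρ : ModPGaloisRep ℚ (ZMod 5) 2} (hρ : W.IsTorsionGaloisRep 5 ρ) :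
    W'.IsTorsionGaloisRep 5 ρ := by
  obtain ⟨e', he'⟩ := h
  obtain ⟨e, he⟩ := hρ
  refine ⟨e'.trans e, fun σ P => ?_⟩
  rw [AddEquiv.trans_apply, AddEquiv.trans_apply, he', he]

/-- An integer of absolute value below a prime `q` and nonzero is not divisible by `q`. -/
theorem not_dvd_of_natAbs_lt {q : ℕ} {z : ℤ} (hz : z ≠ 0) (hlt : z.natAbs < q) : ¬ (q : ℤ) ∣ z := by
  intro h
  have h1 : q ∣ z.natAbs := by
    rcases h with ⟨k, hk⟩
    exact ⟨k.natAbs, by rw [hk, Int.natAbs_mul, Int.natAbs_natCast]⟩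
  have h2 : 0 < z.natAbs := Int.natAbs_pos.mpr hz
  exact absurd (Nat.le_of_dvd h2 h1) (not_le.mpr hlt)

/-! ## §4 The assembly: N1 + N2′ + F2 (+ L0–L6, tree facts) ⇒ `CDT_three_five_switch` ⇔ `stub_switch` -/

/-- **The Deuring road (gen 3).**  Hypotheses: Fisher 13.2 (i) over `ℚ` (tree named fact), Fisher 13.2
(ii) over `𝔽_q` (N2′), Deuring–Waterhouse (N1), the gen-2 certificate atom F2, the tree's PROVED
`hasGlobalMinimalModel_rat` (`GlobalMinimalModelProofs.hasGlobalMinimalModel_rat_holds`) and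
`isTorsionGaloisRep_smul` (`MatarNekovar2019…ClauseThreeProofs`, PROVED; both passed as hypotheses only to
keep this sketch's imports light).  NONE of the stub's three standing hypotheses is used. -/
theorem switch_of_deuringRoad (hF : thm132_geomTorsionFive_of_hesseFamily)
    (hFii : Thm132iiPrimeField) (hDeu : DeuringOrdinaryExistence) (hF2 : FrobeniusCertificate)
    (hGM : hasGlobalMinimalModel_rat)
    (hsmul : ∀ (X : WeierstrassCurve ℚ) (C : VariableChange ℚ) {n : ℕ} [Fact n.Prime]
      {ρ : ModPGaloisRep ℚ (ZMod n) 2}, X.IsTorsionGaloisRep n ρ → (C • X).IsTorsionGaloisRep n ρ) :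
    CDT_three_five_switch := by
  intro W _ _ _ ρ hρ _
  -- Step 0: integral invariants `c₄, c₆`, `W ≅ baseF c₄ c₆`
  obtain ⟨c₄, c₆, CW, hc, hCW⟩ := exists_integral_base W
  haveI hbaseQ : (baseF (c₄ : ℚ) (c₆ : ℚ)).IsElliptic := by rw [← hCW]; infer_instance
  have hWcong : Congr (baseF (c₄ : ℚ) (c₆ : ℚ)) W := congr_symm (congr_of_smul_eq CW hCW)
  have hcZ : c₄ ^ 3 - c₆ ^ 2 ≠ 0 := by
    intro h0
    apply hc
    have : (c₄ : ℚ) ^ 3 - (c₆ : ℚ) ^ 2 = 0 := by exact_mod_cast h0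
    linarith
  -- Step 1: the auxiliary prime `q ≡ 2 (mod 15)`, `q > max(16, |c₄³ − c₆²|)`
  obtain ⟨q, hqprime, hqN, hq15⟩ := exists_prime_gt_mod15 (16 + (c₄ ^ 3 - c₆ ^ 2).natAbs)
  haveI : Fact q.Prime := ⟨hqprime⟩
  haveI : NeZero q := ⟨hqprime.ne_zero⟩
  have hq17 : 17 ≤ q := by omega
  have hq3 : q % 3 = 2 := by omega
  have hq5 : q % 5 = 2 ∨ q % 5 = 3 := Or.inl (by omega)
  have h5 : ((5 : ℕ) : ZMod q) ≠ 0 := by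
    rw [Ne, ZMod.natCast_eq_zero_iff]
    intro hd
    have := Nat.le_of_dvd (by norm_num) hd
    omega
  have hqc : ¬ (q : ℤ) ∣ c₄ ^ 3 - c₆ ^ 2 := not_dvd_of_natAbs_lt hcZ (by omega)
  haveI hbase : (baseF (c₄ : ZMod q) (c₆ : ZMod q)).IsElliptic := isElliptic_baseF_zmod q (by omega) c₄ c₆ hqc
  -- Step 2: a trace representative `t' ≡ a_q(base) (mod 5)`, `3 ∤ t'`, `0 < t'² < 4q`
  obtain ⟨t', ht'5, ht'3, ht'sq⟩ := exists_traceRep q (by omega) (trace q (baseF (c₄ : ZMod q) (c₆ : ZMod q)))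
  have ht'0 : t' ≠ 0 := by rintro rfl; exact ht'3 (dvd_zero 3)
  -- Step 3: Deuring — an ordinary curve over `𝔽_q` with trace `t'`
  obtain ⟨E₀, hE₀, htrE₀⟩ := hDeu q t' ht'0 ht'sq
  haveI := hE₀
  -- Step 4: same Frobenius class on the `5`-torsion ⇒ direct `5`-congruence over `𝔽_q`
  have hcong : DirectCongrFive (baseF (c₄ : ZMod q) (c₆ : ZMod q)) E₀ h5 :=
    directCongrFive_of_trace_modEq q hq5 h5 _ E₀ (by rw [htrE₀, ht'5])
  -- Step 5: Fisher 13.2 (ii) over `𝔽_q`: `E₀ ≅ E_{l̄,m̄}`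
  obtain ⟨lq, mq, Cq, hCq⟩ := hFii q (by omega) h5 _ E₀ (c₄ : ZMod q) (c₆ : ZMod q) rfl hcong
  -- Step 6: lift `(l̄ : m̄)` to integers
  obtain ⟨l, hl⟩ : ∃ l : ℤ, (l : ZMod q) = lq := ⟨(ZMod.cast lq : ℤ), ZMod.intCast_zmod_cast lq⟩
  obtain ⟨m, hm⟩ : ∃ m : ℤ, (m : ZMod q) = mq := ⟨(ZMod.cast mq : ℤ), ZMod.intCast_zmod_cast mq⟩
  have hEq : (memberF (c₄ : ZMod q) (c₆ : ZMod q) (l : ZMod q) (m : ZMod q)).IsElliptic := by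
    rw [hl, hm, ← hCq]; infer_instance
  have htrq : trace q (memberF (c₄ : ZMod q) (c₆ : ZMod q) (l : ZMod q) (m : ZMod q)) = t' := by
    rw [hl, hm, ← hCq, trace_smul, htrE₀]
  -- Step 7: the member over `ℚ`, a globally minimal model, good reduction at `q`, `a_q = t'`
  set E' : WeierstrassCurve ℚ := memberF (c₄ : ℚ) (c₆ : ℚ) (l : ℚ) (m : ℚ) with hE'
  haveI hE'ell : E'.IsElliptic := isElliptic_memberF_of_zmod c₄ c₆ l m q hq17 hEq
  obtain ⟨C, hCmin⟩ := hGM E'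
  haveI := hCmin
  obtain ⟨hgood, htr⟩ := member_reduction c₄ c₆ l m q hq17 hEq C
  -- Step 8: the `3`-side — `Frob_q` has order `8` on `E'[3]` (atom F2)
  have h3 : ¬ (3 : ℤ) ∣ (C • E').frobeniusTrace q := by rw [htr, htrq]; exact ht'3
  obtain ⟨ρ₃, hρ₃⟩ := exists_isTorsionGaloisRep E' 3
  have hirr3 : ρ₃.IsAbsIrreducibleOverSqrt (-3) := hF2 (C • E') q hq3 hgood h3 ρ₃ (hsmul _ C hρ₃)
  -- Step 9: the `5`-side — Fisher 13.2 (i) over `ℚ` (tree named fact)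
  have hc5 : Congr E' W :=
    congr_trans (hF (baseF (c₄ : ℚ) (c₆ : ℚ)) E' (c₄ : ℚ) (c₆ : ℚ) (l : ℚ) (m : ℚ) rfl hE') hWcong
  exact ⟨E', hE'ell, isTorsionGaloisRep_of_congr hc5 hρ, ρ₃, hρ₃, hirr3⟩

end

end Summit.ABC.ABC.Cruxes.FreyModularity.StubSwitchK1G3
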